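import Literature.NumberTheory.EllipticCurves.Kato2004.MemberHullValueInputs
import HarnessLib

/-!
# Kato 2004 (Astérisque 295) at Kato's member — the IDEAL-HULL re-type of `MemberHullValueInputs`
# (13.14 / Bourbaki AC VII §4.2 made canonical: the hull of `𝐇¹_Γ(T)⁰` is taken INSIDE `Λ = ℤ_p⟦X⟧`, so
# Kato's zeta element `z_γ⁰` and the multiplier `λ` become POWER SERIES and Thm. 12.5 (3) reads
# `ℓ_𝔮(𝐇²) ≤ ℓ_𝔮(Λ ⧸ (z))` off `(p)`): the hypothesis STRUCTURE `MemberHullIdealInputs` and its conversions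
# with `MemberHullValueInputs` — NO new named fact (zero debt)

Topic `NumberTheory/EllipticCurves`, sub-directory `Kato2004` (namespace = path).  Seat `bsd-potss-rkm`
(generation 10, cell `bsd-potss`; crux M = item stmt-BirchSwinnertonDyer-19196 `ReducibleKatoMember` of the
routes K9 / K8-t′).  Third sibling of the held named fact `Kato2004.exists_memberHullInputs` (item 19659), after
`exists_memberHullZetaInputs` (p519008; held child 20297 since the resplit of 2026-08-27) and
`exists_memberHullValueInputs` (p527621).  The value package still carries an ABSTRACT hull `j : 𝐇¹_Γ ↪ F`
(`F` finitely generated torsion free, finite cokernel) with `z, λ ∈ F × Λ`.  The Summits-side theorem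
`MemberHullIdeal.MemberHullValueInputs.exists_ideal_hull_of_zetaBody` (seat rkm g10, file
`Theorems/KatoDescentPotSupersingularMemberHullIdeal.lean`) shows that on every pin of the member the hull can be
taken INSIDE `Λ` with the SAME multiplier and the SAME `𝐇²`-side: `rank_Λ 𝐇¹_Γ = 1` there
(`ReducibleOfValueInputs.rank_iwasawaH1_eq_one_of_zetaBody`: non-zero by the value, `≤ 1` by (R2)+(R0)), so
`F ≃ₗ 𝔟 ≤ Λ` of finite index (cell `bsd-cn100`'s `IwasawaAlgebra.exists_linearEquiv_ideal_finite_quotient` =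
Kato 13.14 / Bourbaki AC VII §4 no. 2 in rank one), and lengths only grow along `F/Λz ↪ Λ/Λz′`.

So `MemberHullIdealInputs W p κ γ I 𝐲` := `MemberHullValueInputs` with the hull fields
`(F, [inst], finite_F, torsionFree_F, j, j_injective, finite_coker, z)` REPLACED by
`(j : I.H →ₗ[Λ] Λ, j_injective, finite_coker : Finite (Λ ⧸ range j), z : Λ)` — everything else (`lam`,
`j_y : j 𝐲 = lam • z`, the abstract `𝐇²` with (12.2.1)/Thm. 12.4 (1), the pinned `A = H¹(ℤ[1/p],T)`, the maps of
(14.14.1) with the pin of `ι`, `μ = 0`, the COUNT) verbatim, and Thm. 12.5 (3) off `(p)` in the shape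
`ℓ_𝔮(𝐇²) ≤ ℓ_𝔮(Λ ⧸ Λz)` (i.e. `char(𝐇²) ∣ (z)` away from `(p)` — the printed main-conjecture shape with a
power series on the zeta side).

NO NAMED FACT HERE (review of 2026-08-27, D-0026 (iv)): an `∃`-fact over this structure with the shell of
`exists_memberHullValueInputs` would be a derivable re-packaging of that held fact, so it is NOT filed as a
fourth parallel debt.  Instead: `MemberHullIdealInputs.toMemberHullValueInputs` (take `F := Λ`) and
`MemberHullIdealInputs.ofValueInputs` (from a value package AND a hull realised inside `Λ`) are given here, and
the Summits-side ROUTE-FREE file `Theorems/KatoDescentPotSupersingularReducibleKatoMemberOfIdealInputsNodes.lean`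
proves, as THEOREMS, `Nonempty (MemberHullIdealInputs …)` on every pin of the member from the held fact
`exists_memberHullValueInputs` — CONDITIONALLY on the Gross–Zagier–Kolyvagin input
`rank_eq_analyticRank_of_analyticRank_le_one` (analytic rank `0` ⇒ `W_K(ℚ)` finite, with `Ш(W_K)[p^∞]` finite,
so that `rank_Λ 𝐇¹_Γ = 1` by (R0)+(R2) and the value) — and the full `∀∃` shell in the ideal-hull currency
(`ReducibleOfIdealInputs.forall_nonempty_memberHullIdealInputs_of_valueInputs`).  If the planner ever wants the
ideal-hull form to REPLACE `exists_memberHullValueInputs` as the held input of crux M, the `def … : Prop` is to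
be filed THEN, by a resplit retiring the value fact (net debt `0`).  HONEST SCOPE: nothing is booked; BSD is
not advanced.  Referee flag `Kato-12.6-13.10-14.16(2)-member-reading-reducible` as for the siblings.

## References

* K. Kato, *p-adic Hodge theory and values of zeta functions of modular forms*, Astérisque 295 (2004):
  (12.2.1) (p. 220), Thm. 12.4 (p. 221), Thm. 12.5 (pp. 221–222), Thm. 12.6, Rem. 12.7 (p. 222), Lemma 13.10
  (1) (p. 230), 13.14 (p. 234), §14.8 (p. 238), §14.14 (14.14.1)–(14.14.2) (p. 243), Prop. 14.16 (2) (p. 244)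
  — store key `paper:doi-10-24033-ast-639`, read through `MemberHullInputs.lean`. [Kato2004Asterisque]
* N. Bourbaki, *Algèbre commutative* VII §4 no. 2. [BourbakiAC5to7]
* C. Wuthrich, Doc. Math. 19 (2014), Lemma 12 (p. 395), Lemma 14 (p. 396). [Wuthrich2014]
* R. Greenberg, LNM 1716 (1999), Prop. 4.13 and §3. [GreenbergLNM1716]
* C.-H. Kim, Amer. J. Math. 148 (2026), §3.2.3. [Kim2022StructureSelmer]
* Tree: `MemberHullValueInputs.lean`, `MemberHullZetaInputs.lean`, `MemberHullInputs.lean` (the siblings);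
  Summits side (not imported): `Theorems/KatoDescentPotSupersingularMemberHullIdeal.lean`,
  `…ReducibleKatoMemberOfIdealInputsNodes.lean`.
-/

noncomputable section

open scoped NumberField TensorProduct
open Field IsDedekindDomain CongruenceSubgroup
open Literature.NumberTheory.GaloisRepresentations
open Literature.NumberTheory.EllipticCurves Literature.NumberTheory.EllipticCurves.ModularForms
open Literature.NumberTheory.EllipticCurves.Kato2004
open Literature.NumberTheory.EllipticCurves.Kato2004.EulerSystemValues Rat.HeightOneSpectrum
open Literature.NumberTheory.EllipticCurves.IwasawaAlgebra

namespace Literature.NumberTheory.EllipticCurves.Kato2004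

section Package

variable (W : WeierstrassCurve ℚ) [W.IsElliptic] (p : ℕ) [Fact p.Prime]
  [ContinuousSMul ℤ_[p] (W.tateModule p)] (κ : ZpExtension ℚ p) (γ : absoluteGaloisGroup ℚ)
  (I : IwasawaH1Data W p κ γ) (y : I.H)

/-- **Kato's rank-`0` descent inputs at his own lattice, IDEAL-HULL re-type of `MemberHullValueInputs` —
hypothesis structure (a package of the printed statements; nothing asserted).**  For an elliptic curve `W/ℚ`
(intended: Kato's member `W_K`), a pinned Iwasawa cohomology `I : IwasawaH1Data W p κ γ` and an element
`y : I.H` (the `Λ`-adic class of a `ZetaBody` family): an embedding `j : I.H ↪ Λ` of finite index (the reflexive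
hull of the rank-one `𝐇¹_Γ`, 13.14 / Bourbaki AC VII §4 no. 2 / Wuthrich L.12) with the image `z ∈ Λ` of
Kato's normalised zeta element `z_γ⁰` and the multiplier `lam ∈ Λ` of Lemma 13.10 (1), `j y = lam • z`; the
abstract `H2 = 𝐇²(T)⁰`, finitely generated torsion ((12.2.1), Thm. 12.4 (1)); the module `A = H¹(ℤ[1/p],T)`
PINNED to `integralH1 (tateRep W p) p (κ.layerSubgroup 0)`; the maps `ι`, `π` of (14.14.1) with `π` surjective,
exactness in the middle and the PIN `toH1 ∘ ι ∘ mk = proj₀`; Thm. 12.5 (3) + Rem. 12.7 off `(p)` in the shape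
`ℓ_𝔮(𝐇²) ≤ ℓ_𝔮(Λ ⧸ Λz)`; `μ(𝐇²(T)⁰) = 0` (Wuthrich L.14, reducible `W[p]`); and the COUNT Prop. 14.16 (2) +
§14.8 / Greenberg 4.13 + Kim §3.2.3 + Thm. 12.5 (1) for the element `y`.  EXACTLY `MemberHullValueInputs` with
the abstract hull `(F, j, z ∈ F)` replaced by `(j : I.H →ₗ[Λ] Λ, z ∈ Λ)` (module docstring).
[cite: Kato2004Asterisque, Thm. 12.4 (1) (p. 221), Thm. 12.5 (3) (p. 222), Thm. 12.6 and Rem. 12.7 (p. 222), Lemma 13.10 (1) (p. 230), 13.14 (p. 234), §14.14 (14.14.1)–(14.14.2) (p. 243), Prop. 14.16 (2) (p. 244), §14.8 (p. 238)]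
[cite: Wuthrich2014, Lemma 12 (p. 395), Lemma 14 (p. 396)] [cite: GreenbergLNM1716, Prop. 4.13 and §3 after Lemma 3.3]
[cite: Kim2022StructureSelmer, §3.2.3 display before Thm. 3.7 (PDF p. 16)] [cite: BourbakiAC5to7, Ch. VII §4 no. 2] -/
structure MemberHullIdealInputs : Type 1 where
  /-- The reflexive hull `𝐇¹_Γ ↪ (𝐇¹_Γ)^{**} ≅ Λ` (13.14 / Wuthrich L.12; rank one), as an embedding into `Λ`. -/
  j : I.H →ₗ[IwasawaAlgebra p] IwasawaAlgebra p
  /-- `j` is injective. -/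
  j_injective : Function.Injective j
  /-- The hull has finite (pseudo-null) cokernel: `Λ ⧸ j(𝐇¹_Γ)` finite. -/
  finite_coker : Finite (IwasawaAlgebra p ⧸ LinearMap.range j)
  /-- The image in `Λ` of Kato's normalised zeta element `z_γ⁰` (Thm. 12.6 + 13.14): a power series. -/
  z : IwasawaAlgebra p
  /-- Lemma 13.10 (1): the multiplier `λ ∈ Λ` of the `(c,d,a(A))`-class. -/
  lam : IwasawaAlgebra p
  /-- Lemma 13.10 (1): `j y = λ • z_γ⁰`. -/
  j_y : j y = lam • z
  /-- `H2 = 𝐇²(T)⁰`, abstract. -/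
  H2 : Type
  [addCommGroupH2 : AddCommGroup H2]
  [moduleH2 : _root_.Module (IwasawaAlgebra p) H2]
  /-- (12.2.1): `𝐇²` is finitely generated. -/
  finite_H2 : Module.Finite (IwasawaAlgebra p) H2
  /-- Thm. 12.4 (1): `𝐇²` is torsion. -/
  isTorsion_H2 : Module.IsTorsion (IwasawaAlgebra p) H2
  /-- `A = H¹(ℤ[1/p], T)` as a `Λ`-module (through the augmentation), pinned by `toH1`. -/
  A : Type
  [addCommGroupA : AddCommGroup A]
  [moduleA : _root_.Module (IwasawaAlgebra p) A]
  /-- The PIN of `A`: an additive map to `H¹(ℚ, T_pW)` at the bottom layer `κ.layerSubgroup 0 = Γ_ℚ` … -/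
  toH1 : A →+ H1 (tateRep W p) (κ.layerSubgroup 0)
  /-- … injective … -/
  toH1_injective : Function.Injective toH1
  /-- … with image exactly the integral classes `H¹(ℤ[1/p], T_pW)` (§8.2, Lemma 8.5) … -/
  mem_range_toH1_iff : ∀ x : H1 (tateRep W p) (κ.layerSubgroup 0),
    x ∈ Set.range toH1 ↔ x ∈ integralH1 (tateRep W p) p (κ.layerSubgroup 0)
  /-- … and `Λ` acting on `A` through the augmentation `g ↦ g(0)` (so `X` acts as `0`). -/
  toH1_smul : ∀ (g : IwasawaAlgebra p) (a : A), toH1 (g • a) = PowerSeries.constantCoeff g • toH1 a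
  /-- (14.14.1), first map `𝐇¹_Γ/X𝐇¹_Γ → H¹(ℤ[1/p],T)`. -/
  ι : coinvariants p I.H →ₗ[IwasawaAlgebra p] A
  /-- (14.14.1), second map `H¹(ℤ[1/p],T) → 𝐇²[X]`. -/
  π : A →ₗ[IwasawaAlgebra p] invariants p H2
  /-- (14.14.1): `π` surjective. -/
  π_surjective : Function.Surjective π
  /-- (14.14.1): exact in the middle. -/
  exact_ι_π : Function.Exact ι π
  /-- The PIN of `ι`: `ι(x mod X) = proj₀ x` in `H¹(ℚ, T_pW)` (§13.8 / (14.14.1); `IwasawaH1Data.projZero`). -/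
  toH1_ι : ∀ x : I.H, toH1 (ι (Submodule.Quotient.mk x)) = I.proj 0 x
  /-- Thm. 12.5 (3) with Rem. 12.7 (potentially good `p`: `𝐇²_loc = 0`), on the `Δ`-trivial component:
  `ℓ_𝔮(𝐇²) ≤ ℓ_𝔮(Λ/Λz_γ)` at every height-one `𝔮 ≠ (p)` (`char(𝐇²) ∣ (z)` away from `(p)`). -/
  divisibility_offP : ∀ 𝔮 : PrimeSpectrum (IwasawaAlgebra p), 𝔮.asIdeal.height = 1 →
    𝔮.asIdeal ≠ augIdealP p →
      Module.lengthAt (IwasawaAlgebra p) H2 𝔮 ≤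
        Module.lengthAt (IwasawaAlgebra p) (IwasawaAlgebra p ⧸ (IwasawaAlgebra p) ∙ z) 𝔮
  /-- Wuthrich 2014 Lemma 14 + global duality (reducible `W[p]`, `p` odd): `μ(𝐇²(T)⁰) = 0`. -/
  mu_H2 : muInvariant p H2 = 0
  /-- THE COUNT (Prop. 14.16 (2) for the element `y₀ = proj₀ y` + §14.8 / Greenberg Prop. 4.13 & §3 +
  Kim §3.2.3 + Thm. 12.5 (1) with Lemma 13.10 (1); module docstring of `MemberHullInputs.lean`):
  `ord_p #Ш(W)[p^∞] + v_p(Tam W) + ord_p [A : Λ·ι(ȳ)] ≤ ord_p(L(W,1)/Ω(W)) + v_p(λ(0)) + ord_p #(𝐇²/X𝐇²)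
  + 3·ord_p #W(ℚ)_tors`. -/
  count : ∃ q : ℚ, W.entireLFunction 1 / (W.realPeriodRat : ℂ) = (q : ℂ) ∧
    (padicValNat p (Nat.card (AddCommGroup.primaryComponent W.sha p)) : ℤ) +
        padicValNat p W.tamagawaProduct +
        padicValNat p (Nat.card (A ⧸ (IwasawaAlgebra p) ∙ ι (Submodule.Quotient.mk y))) ≤
      padicValRat p q + ((PowerSeries.constantCoeff lam).valuation : ℤ) +
        padicValNat p (Nat.card (coinvariants p H2)) + 3 * (padicValNat p W.torsionOrder : ℤ)

attribute [instance] MemberHullIdealInputs.addCommGroupH2 MemberHullIdealInputs.moduleH2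
  MemberHullIdealInputs.addCommGroupA MemberHullIdealInputs.moduleA

end Package

/-! ## Conversions with the sibling (no arithmetic here) -/

section Conversions

variable {W : WeierstrassCurve ℚ} [W.IsElliptic] {p : ℕ} [Fact p.Prime]
  [ContinuousSMul ℤ_[p] (W.tateModule p)] {κ : ZpExtension ℚ p} {γ : absoluteGaloisGroup ℚ}
  {I : IwasawaH1Data W p κ γ} {y : I.H}

namespace MemberHullIdealInputs

/-- **Every ideal-hull package is a value package with `F := Λ`** (`Λ` is a finitely generated torsion-free
`Λ`-module). [cite: Kato2004Asterisque, 13.14 (p. 234) and Thm. 12.5 (3) (p. 222)] -/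
def toMemberHullValueInputs (Q : MemberHullIdealInputs W p κ γ I y) : MemberHullValueInputs W p κ γ I y where
  F := IwasawaAlgebra p
  finite_F := inferInstance
  torsionFree_F := inferInstance
  j := Q.j
  j_injective := Q.j_injective
  finite_coker := Q.finite_coker
  z := Q.z
  lam := Q.lam
  j_y := Q.j_y
  H2 := Q.H2
  finite_H2 := Q.finite_H2
  isTorsion_H2 := Q.isTorsion_H2
  A := Q.A
  toH1 := Q.toH1
  toH1_injective := Q.toH1_injective
  mem_range_toH1_iff := Q.mem_range_toH1_iff
  toH1_smul := Q.toH1_smul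
  ι := Q.ι
  π := Q.π
  π_surjective := Q.π_surjective
  exact_ι_π := Q.exact_ι_π
  toH1_ι := Q.toH1_ι
  divisibility_offP := Q.divisibility_offP
  mu_H2 := Q.mu_H2
  count := Q.count

/-- **From a value package and a hull realised inside `Λ`** (an injective `j' : 𝐇¹_Γ → Λ` of finite index and
`z' ∈ Λ` with `j' 𝐲 = λ • z'` and `ℓ_𝔮(𝐇²) ≤ ℓ_𝔮(Λ ⧸ Λz')` off `(p)` — supplied on the member's pins by the
Summits theorem `MemberHullIdeal.MemberHullValueInputs.exists_ideal_hull_of_zetaBody`) **to an ideal-hull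
package** with the same `λ` and `𝐇²`-side. [cite: Kato2004Asterisque, 13.14 (p. 234) and Thm. 12.5 (3) (p. 222)] -/
def ofValueInputs (P : MemberHullValueInputs W p κ γ I y)
    (j' : I.H →ₗ[IwasawaAlgebra p] IwasawaAlgebra p) (hj' : Function.Injective j')
    (hfin : Finite (IwasawaAlgebra p ⧸ LinearMap.range j')) (z' : IwasawaAlgebra p)
    (hjy : j' y = P.lam • z')
    (hdiv : ∀ 𝔮 : PrimeSpectrum (IwasawaAlgebra p), 𝔮.asIdeal.height = 1 → 𝔮.asIdeal ≠ augIdealP p →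
      Module.lengthAt (IwasawaAlgebra p) P.H2 𝔮 ≤
        Module.lengthAt (IwasawaAlgebra p) (IwasawaAlgebra p ⧸ (IwasawaAlgebra p) ∙ z') 𝔮) :
    MemberHullIdealInputs W p κ γ I y where
  j := j'
  j_injective := hj'
  finite_coker := hfin
  z := z'
  lam := P.lam
  j_y := hjy
  H2 := P.H2
  finite_H2 := P.finite_H2
  isTorsion_H2 := P.isTorsion_H2
  A := P.A
  toH1 := P.toH1
  toH1_injective := P.toH1_injective
  mem_range_toH1_iff := P.mem_range_toH1_iff
  toH1_smul := P.toH1_smul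
  ι := P.ι
  π := P.π
  π_surjective := P.π_surjective
  exact_ι_π := P.exact_ι_π
  toH1_ι := P.toH1_ι
  divisibility_offP := hdiv
  mu_H2 := P.mu_H2
  count := P.count

/-- `ι` is injective on every ideal-hull package (`κ` cyclotomic, `γ` a topological generator), as for the
siblings. [cite: Kato2004Asterisque, §14.14 (14.14.1) (p. 243) and §13.8 (p. 228)] -/
theorem ι_injective (Q : MemberHullIdealInputs W p κ γ I y) (hκ : κ.IsCyclotomic)
    (hγ : κ.IsTopGenerator γ) : Function.Injective Q.ι :=
  Q.toMemberHullValueInputs.ι_injective hκ hγ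

/-- The `(H2, A, toH1, ι, π)`-fields of an ideal-hull package form a descent package `IwasawaH2Data W p κ γ I`.
[cite: Kato2004Asterisque, §14.14 (14.14.1) (p. 243), (12.2.1) (p. 220), Thm. 12.4 (1) (p. 221)] -/
def toIwasawaH2Data (Q : MemberHullIdealInputs W p κ γ I y) (hκ : κ.IsCyclotomic)
    (hγ : κ.IsTopGenerator γ) : IwasawaH2Data W p κ γ I :=
  Q.toMemberHullValueInputs.toIwasawaH2Data hκ hγ

end MemberHullIdealInputs

end Conversions

end Literature.NumberTheory.EllipticCurves.Kato2004

end
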